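import Mathlib
import HarnessLib
import Literature.AlgebraicGeometry.Ramification.InertiaNormalSylow
import Summits.ResolutionOfSingularities.ResolutionOfSingularities.Theorems.FrobeniusLadderFInjectiveMacaulayficationClosedPointsOfClosedFinite

/-!
# The topological standing hypotheses of the threefold Phase-0 bookkeeping hold in the crux setting (crux `WildQuotients.WildQuotientResolution`)

Crux stmt-ResolutionOfSingularities-15640 (`WildQuotientResolution`), registered stub
`stub_phaseZeroHighDim`, move-game track. The round-bookkeeping theorems of this track
(✓`PointMoveNpcClosedPoints`, ✓`PointMoveNpcFinite`, ✓`PointMoveNpcFinitePersist`,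
✓`CurveMoveNpcPersist`) carry instance hypotheses `[JacobsonSpace X′]`, `[JacobsonSpace X♯]`,
`[NoetherianSpace X♯]`. This file discharges them once from the data of the stub: `X₁ → Spec k`
separated, locally of finite type and quasi-compact, `q : X′ → X₁` finite, and any model
`π : X♯ → X′` that is proper (e.g. a blow-up of a coherent ideal): everything is locally of finite
type over the Jacobson ring `k` (Mathlib `LocallyOfFiniteType.jacobsonSpace`) and Noetherian
(locally Noetherian + quasi-compact over the compact `Spec k`).

* `jacobsonSpace_of_locallyOfFiniteType_field` — `X` locally of finite type over a field is a
  Jacobson space.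
* (tree ✓`FInjectiveMacaulayfication.ClosedPointsOfClosedFinite.isNoetherian_of_locallyOfFiniteType_of_quasiCompact`
  — … and quasi-compact over the field ⇒ Noetherian scheme, hence `NoetherianSpace`.)
* `jacobsonSpace_base`, `jacobsonSpace_model`, `noetherianSpace_model` — the three hypotheses in
  the crux setting.

[OURS · crux stmt-ResolutionOfSingularities-15640 · helper toward `stub_phaseZeroHighDim`
(threefold Phase 0, bookkeeping); folklore, counted 0; AI-level work, weaker than expert review.]
-/

-- single-problem summit: the doubled namespace component `ResolutionOfSingularities` is forced
set_option linter.dupNamespace false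

namespace Summit.ResolutionOfSingularities.ResolutionOfSingularities.Theorems.WildQuotientResolution.PointMoveNoNpcCurves

open CategoryTheory AlgebraicGeometry TopologicalSpace

/-- A scheme locally of finite type over a field is a Jacobson space. [folklore; Stacks 01TB] -/
theorem jacobsonSpace_of_locallyOfFiniteType_field {k : Type} [Field k] {X : Scheme.{0}}
    (s : X ⟶ Spec (.of k)) [LocallyOfFiniteType s] : JacobsonSpace X :=
  LocallyOfFiniteType.jacobsonSpace s

/-- **`X′` is a Jacobson space** in the crux setting (`X₁ → Spec k` locally of finite type,
`q : X′ → X₁` finite). [folklore] -/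
theorem jacobsonSpace_base {k : Type} [Field k] {X' X₁ : Scheme.{0}} (f : X₁ ⟶ Spec (.of k))
    (q : X' ⟶ X₁) [LocallyOfFiniteType f] [IsFinite q] : JacobsonSpace X' :=
  jacobsonSpace_of_locallyOfFiniteType_field (q ≫ f)

/-- **A model locally of finite type over `X′` (e.g. a proper one, a blow-up) is a Jacobson
space** in the crux setting. [folklore] -/
theorem jacobsonSpace_model {k : Type} [Field k] {Xs X' X₁ : Scheme.{0}} (f : X₁ ⟶ Spec (.of k))
    (q : X' ⟶ X₁) (π : Xs ⟶ X') [LocallyOfFiniteType f] [IsFinite q] [LocallyOfFiniteType π] :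
    JacobsonSpace Xs :=
  jacobsonSpace_of_locallyOfFiniteType_field ((π ≫ q) ≫ f)

/-- **A quasi-compact model locally of finite type over `X′` (e.g. a proper one) has Noetherian
underlying space** in the crux setting (`X₁ → Spec k` moreover quasi-compact). [folklore] -/
theorem noetherianSpace_model {k : Type} [Field k] {Xs X' X₁ : Scheme.{0}} (f : X₁ ⟶ Spec (.of k))
    (q : X' ⟶ X₁) (π : Xs ⟶ X') [LocallyOfFiniteType f] [QuasiCompact f] [IsFinite q]
    [LocallyOfFiniteType π] [QuasiCompact π] : NoetherianSpace Xs := by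
  haveI : IsNoetherian Xs :=
    FInjectiveMacaulayfication.ClosedPointsOfClosedFinite.isNoetherian_of_locallyOfFiniteType_of_quasiCompact
      ((π ≫ q) ≫ f)
  infer_instance

end Summit.ResolutionOfSingularities.ResolutionOfSingularities.Theorems.WildQuotientResolution.PointMoveNoNpcCurves
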